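import Summits.Parity.GeneralizedHardyLittlewood.Theorems.LeeYangFibresRelativeDimOneDefs
import Literature.NumberTheory.Sieve.GallagherSingularSeries
import HarnessLib

/-!
# Route `LeeYangFibres`, crux `RelativeDimOne` (stmt-Parity-14113), line `SketchIdeator1`:
B2a `LocalAverage` — the local factors of translate-constellations multiply exactly on average

For a `t`-system `Ψ` of one-dimensional affine-linear forms, a shift vector `H ∈ ℤ^m` and the
translate-constellation `Ψ^{(H)} = Ψ ⊔ (Ψ + H₁) ⊔ ⋯ ⊔ (Ψ + H_m)` (`translateFamily Ψ H`),
Gallagher's exact averaging identity holds: for a finite set `S` of primes with product `P` and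
ANY integer box `∏_j [a_j, a_j + P)`,

  `∑_{H ∈ box} ∏_{p ∈ S} β_p(Ψ^{(H)}) = P^m ∏_{p ∈ S} β_p(Ψ)^{m+1}`

(`stub_localAverage : LocalAverage`, the registered stub of the skeleton
`Cruxes/RelativeDimOne/Lines/SketchIdeator1.lean`).

## Proof

All steps are exact identities.
1. `d = 1` unfolding (`localFactor_fin_one`, `localFactor_translateFamily`):
   `β_q(Ψ^{(H)}) = q⁻¹ ∑_{c < q} f_q(c) ∏_j f_q(c + H_j)` with `f_q(x) = ∏_i Λ_q(ψ_i(x))`.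
2. Periodicity (`prod_localVonMangoldt_congr`, `localFactor_translateFamily_congr`): `f_q(x)`
   depends only on `x mod q` (`Int.gcd_emod`), so `β_q(Ψ^{(H)})` depends only on `H mod q`
   coordinatewise.
3. Per-modulus identity (`sum_localFactor_translateFamily`): summing over `H ∈ [0, q)^m` first
   (`Finset.prod_univ_sum`), each inner sum `∑_{h < q} f_q(c + h) = ∑_{h < q} f_q(h) = q β_q(Ψ)`
   is a shifted complete residue sum (`sum_range_add_of_periodic`), whence `q^m β_q(Ψ)^{m+1}`.
4. Chinese remainder theorem over `S` (`sum_prod_localFactor_translateFamily`), by induction on `S`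
   exactly as in `Literature.NumberTheory.Sieve.Gallagher.sum_prod_localFactor`, reusing the fibre
   lemma `Literature.NumberTheory.Sieve.Gallagher.sum_filter_modVec_eq` on the box `[0, P)^m ⊆ ℕ^m`.
5. Transfer to an arbitrary integer box (`sum_box_eq_sum_range_of_periodic`): reduction modulo `P`
   is a bijection `∏_j [a_j, a_j + P) → [0, P)^m` preserving every coordinate modulo `P`.

References: P. X. Gallagher, Mathematika 23 (1976), §2 p. 7 [Gallagher1976]; B. Green, T. Tao,
Ann. of Math. 171 (2010), (1.6) [GreenTao2010].
-/

noncomputable section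

open scoped BigOperators
open Finset Literature.NumberTheory.Sieve

namespace Summit.Parity.GeneralizedHardyLittlewood.Cruxes.RelativeDimOne.TranslateAmplification

variable {t m : ℕ}

/-! ### Step 1: `d = 1` unfoldings -/

/-- The weights over a translate-constellation split along the shifts, for an arbitrary weight
`w : ℤ → ℝ`: `∏_{(j,i)} w(ψ_i(n + H'_j)) = (∏_i w(ψ_i(n))) · ∏_j ∏_i w(ψ_i(n + H_j))`. -/
theorem prod_translateFamily_weight (w : ℤ → ℝ) (Ψ : Fin t → AffLinForm 1) (H : Fin m → ℤ)
    (n : Fin 1 → ℤ) :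
    ∏ k, w ((translateFamily Ψ H k).eval n) =
      (∏ i, w ((Ψ i).eval n)) * ∏ j : Fin m, ∏ i, w ((Ψ i).eval (fun l => n l + H j)) := by
  rw [← Fintype.prod_equiv finProdFinEquiv
        (fun ji : Fin (m + 1) × Fin t => w ((translateFamily Ψ H (finProdFinEquiv ji)).eval n))
        (fun k => w ((translateFamily Ψ H k).eval n)) (fun _ => rfl)]
  rw [Fintype.prod_prod_type]
  simp only [translateFamily_apply, translateForm_eval]
  rw [Fin.prod_univ_succ]
  simp only [shiftVec_zero, shiftVec_succ, add_zero]

/-- `β_q` of a one-dimensional system as a sum over the representatives `0, …, q - 1`: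
`β_q(Φ) = q⁻¹ ∑_{c < q} ∏_i Λ_q(φ_i(c))`. -/
theorem localFactor_fin_one {T : ℕ} (Φ : Fin T → AffLinForm 1) (q : ℕ) :
    localFactor Φ q =
      (q : ℝ)⁻¹ * ∑ c ∈ range q, ∏ i, localVonMangoldt q ((Φ i).eval fun _ => (c : ℤ)) := by
  rw [localFactor, sum_piFinset_fin_one, pow_one]

/-- `β_q` of a translate-constellation, unfolded:
`β_q(Ψ^{(H)}) = q⁻¹ ∑_{c < q} f_q(c) ∏_j f_q(c + H_j)`, `f_q(x) = ∏_i Λ_q(ψ_i(x))`. -/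
theorem localFactor_translateFamily (Ψ : Fin t → AffLinForm 1) (H : Fin m → ℤ) (q : ℕ) :
    localFactor (translateFamily Ψ H) q =
      (q : ℝ)⁻¹ * ∑ c ∈ range q,
        (∏ i, localVonMangoldt q ((Ψ i).eval fun _ => (c : ℤ))) *
          ∏ j : Fin m, ∏ i, localVonMangoldt q ((Ψ i).eval fun _ => (c : ℤ) + H j) := by
  rw [localFactor_fin_one]
  congr 1
  refine Finset.sum_congr rfl fun c _ => ?_
  rw [prod_translateFamily_weight]

/-! ### Step 2: periodicity -/

/-- `f_q(x) = ∏_i Λ_q(ψ_i(x))` depends only on `x mod q`. -/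
theorem prod_localVonMangoldt_congr (Ψ : Fin t → AffLinForm 1) {q : ℕ} {x y : ℤ}
    (h : x ≡ y [ZMOD q]) :
    ∏ i, localVonMangoldt q ((Ψ i).eval fun _ => x) =
      ∏ i, localVonMangoldt q ((Ψ i).eval fun _ => y) := by
  refine Finset.prod_congr rfl fun i _ => ?_
  have he : (Ψ i).eval (fun _ => x) ≡ (Ψ i).eval (fun _ => y) [ZMOD q] := by
    simp only [AffLinForm.eval, Fin.sum_univ_one]
    exact (h.mul_left _).add_right _
  unfold localVonMangoldt
  rw [← Int.gcd_emod, he.eq, Int.gcd_emod]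

/-- `β_q(Ψ^{(H)})` depends only on the shifts `H_j` modulo `q`. -/
theorem localFactor_translateFamily_congr (Ψ : Fin t → AffLinForm 1) {q : ℕ} {H H' : Fin m → ℤ}
    (h : ∀ j, H j ≡ H' j [ZMOD q]) :
    localFactor (translateFamily Ψ H) q = localFactor (translateFamily Ψ H') q := by
  rw [localFactor_translateFamily, localFactor_translateFamily]
  congr 1
  refine Finset.sum_congr rfl fun c _ => ?_
  congr 1
  refine Finset.prod_congr rfl fun j _ => ?_
  exact prod_localVonMangoldt_congr Ψ ((h j).add_left _)

/-- `β_p(Ψ^{(H)})`, for shifts `H ∈ ℕ^m`, is `n`-periodic (`Gallagher.modVec n`) whenever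
`p ∣ n`. -/
theorem localFactor_translateFamily_modVec (Ψ : Fin t → AffLinForm 1) {p n : ℕ} (hpn : p ∣ n)
    (u : Fin m → ℕ) :
    localFactor (translateFamily Ψ fun j => ((Gallagher.modVec n u j : ℕ) : ℤ)) p =
      localFactor (translateFamily Ψ fun j => (u j : ℤ)) p := by
  refine localFactor_translateFamily_congr Ψ fun j => ?_
  rw [Gallagher.modVec_apply, Int.natCast_emod]
  exact (Int.mod_modEq _ _).of_dvd (Int.natCast_dvd_natCast.2 hpn)

/-- A shifted complete residue sum of a `q`-periodic function on `ℕ` is the unshifted one: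
`∑_{h < q} F(c + h) = ∑_{h < q} F(h)` for `c ≤ q`. -/
theorem sum_range_add_of_periodic {M : Type*} [AddCommMonoid M] {q c : ℕ} (F : ℕ → M)
    (hF : ∀ x, F (x + q) = F x) (hc : c ≤ q) :
    ∑ h ∈ range q, F (c + h) = ∑ h ∈ range q, F h := by
  have h1 : ∑ h ∈ range q, F (c + h) = ∑ x ∈ Ico c (c + q), F x := by
    rw [Finset.sum_Ico_eq_sum_range, add_tsub_cancel_left]
  have h2 : ∑ x ∈ Ico q (c + q), F x = ∑ x ∈ Ico 0 c, F x := by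
    rw [Finset.sum_Ico_eq_sum_range, Finset.sum_Ico_eq_sum_range, add_tsub_cancel_right, tsub_zero]
    refine Finset.sum_congr rfl fun x _ => ?_
    rw [add_comm, hF, zero_add]
  rw [h1, ← Finset.sum_Ico_consecutive F hc (Nat.le_add_left q c), h2, add_comm,
    Finset.sum_Ico_consecutive F (Nat.zero_le c) hc, Finset.range_eq_Ico]

/-! ### Step 3: the per-modulus identity -/

/-- Gallagher's local identity for translate-constellations: for `q ≥ 1`,
`∑_{x ∈ [0, q)^m} β_q(Ψ^{(x)}) = q^m β_q(Ψ)^{m+1}` (sum over the shifts first; each inner sum is a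
shifted complete residue sum `∑_{h < q} f_q(c + h) = q β_q(Ψ)`). -/
theorem sum_localFactor_translateFamily (Ψ : Fin t → AffLinForm 1) {q : ℕ} (hq : 0 < q) (m : ℕ) :
    ∑ x ∈ Fintype.piFinset (fun _ : Fin m => range q),
        localFactor (translateFamily Ψ fun j => (x j : ℤ)) q =
      (q : ℝ) ^ m * localFactor Ψ q ^ (m + 1) := by
  have hq' : (q : ℝ) ≠ 0 := by exact_mod_cast hq.ne'
  -- the complete residue sum `∑_{h < q} f_q(h) = q β_q`
  have hS : ∑ h ∈ range q, ∏ i, localVonMangoldt q ((Ψ i).eval fun _ => (h : ℤ)) =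
      q * localFactor Ψ q := by
    rw [localFactor_fin_one, mul_inv_cancel_left₀ hq']
  -- periodicity of `f_q` on `ℕ`
  have hper : ∀ x : ℕ, ∏ i, localVonMangoldt q ((Ψ i).eval fun _ => ((x + q : ℕ) : ℤ)) =
      ∏ i, localVonMangoldt q ((Ψ i).eval fun _ => (x : ℤ)) := by
    intro x
    refine prod_localVonMangoldt_congr Ψ ?_
    push_cast
    exact Int.add_modEq_right
  -- the shifted complete residue sums
  have hshift : ∀ c ∈ range q,
      ∑ h ∈ range q, ∏ i, localVonMangoldt q ((Ψ i).eval fun _ => (c : ℤ) + (h : ℤ)) =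
        q * localFactor Ψ q := by
    intro c hc
    rw [← hS, ← sum_range_add_of_periodic
      (fun h : ℕ => ∏ i, localVonMangoldt q ((Ψ i).eval fun _ => (h : ℤ))) hper (mem_range.1 hc).le]
    simp only [Nat.cast_add]
  simp_rw [localFactor_translateFamily]
  rw [← Finset.mul_sum, Finset.sum_comm]
  have hinner : ∀ c ∈ range q,
      ∑ x ∈ Fintype.piFinset (fun _ : Fin m => range q),
          (∏ i, localVonMangoldt q ((Ψ i).eval fun _ => (c : ℤ))) *
            ∏ j : Fin m, ∏ i, localVonMangoldt q ((Ψ i).eval fun _ => (c : ℤ) + (x j : ℤ)) =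
        (∏ i, localVonMangoldt q ((Ψ i).eval fun _ => (c : ℤ))) *
          ((q : ℝ) * localFactor Ψ q) ^ m := by
    intro c hc
    rw [← Finset.mul_sum, ← Finset.prod_univ_sum (fun _ : Fin m => range q)
      (fun _ h => ∏ i, localVonMangoldt q ((Ψ i).eval fun _ => (c : ℤ) + (h : ℤ))),
      Finset.prod_const, Finset.card_univ, Fintype.card_fin, hshift c hc]
  rw [Finset.sum_congr rfl hinner, ← Finset.sum_mul, hS, mul_pow,
    mul_assoc (q : ℝ) (localFactor Ψ q), inv_mul_cancel_left₀ hq']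
  ring

/-! ### Step 4: the Chinese remainder theorem over the primes of `S` -/

/-- Independence of the local factors of translate-constellations at distinct primes: for a finite
set `S` of primes with product `P`,
`∑_{u ∈ [0, P)^m} ∏_{p ∈ S} β_p(Ψ^{(u)}) = P^m ∏_{p ∈ S} β_p(Ψ)^{m+1}`
(induction on `S`; the fibres of reduction modulo `∏ S'` are handled by
`Gallagher.sum_filter_modVec_eq`). -/
theorem sum_prod_localFactor_translateFamily (Ψ : Fin t → AffLinForm 1) (m : ℕ) (S : Finset ℕ)
    (hS : ∀ p ∈ S, p.Prime) :
    ∑ u ∈ Fintype.piFinset (fun _ : Fin m => range (∏ p ∈ S, p)),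
        ∏ p ∈ S, localFactor (translateFamily Ψ fun j => (u j : ℤ)) p =
      ((∏ p ∈ S, p : ℕ) : ℝ) ^ m * ∏ p ∈ S, localFactor Ψ p ^ (m + 1) := by
  induction S using Finset.induction_on with
  | empty =>
    simp
  | insert p S hpS ih =>
    have hp : p.Prime := hS p (mem_insert_self _ _)
    have hS' : ∀ q ∈ S, q.Prime := fun q hq => hS q (mem_insert_of_mem hq)
    have ih' := ih hS'
    have hP'pos : 0 < ∏ q ∈ S, q := Finset.prod_pos fun q hq => (hS' q hq).pos
    have hcop : Nat.Coprime p (∏ q ∈ S, q) :=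
      Nat.Coprime.prod_right fun q hq =>
        (Nat.coprime_primes hp (hS' q hq)).2 fun h => hpS (h ▸ hq)
    rw [Finset.prod_insert hpS, Finset.prod_insert hpS]
    simp_rw [Finset.prod_insert hpS]
    have hmaps : ∀ r ∈ Fintype.piFinset (fun _ : Fin m => range (p * ∏ q ∈ S, q)),
        Gallagher.modVec (∏ q ∈ S, q) r ∈
          Fintype.piFinset (fun _ : Fin m => range (∏ q ∈ S, q)) :=
      fun r _ => Fintype.mem_piFinset.2 fun j => mem_range.2 (Nat.mod_lt _ hP'pos)
    rw [← Finset.sum_fiberwise_of_maps_to hmaps]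
    have hinner : ∀ u ∈ Fintype.piFinset (fun _ : Fin m => range (∏ q ∈ S, q)),
        ∑ r ∈ (Fintype.piFinset fun _ : Fin m => range (p * ∏ q ∈ S, q)).filter
            (fun r => Gallagher.modVec (∏ q ∈ S, q) r = u),
          localFactor (translateFamily Ψ fun j => (r j : ℤ)) p *
            ∏ q ∈ S, localFactor (translateFamily Ψ fun j => (r j : ℤ)) q =
          (p : ℝ) ^ m * localFactor Ψ p ^ (m + 1) *
            ∏ q ∈ S, localFactor (translateFamily Ψ fun j => (u j : ℤ)) q := by
      intro u hu
      have hF : ∀ r ∈ (Fintype.piFinset fun _ : Fin m => range (p * ∏ q ∈ S, q)).filter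
          (fun r => Gallagher.modVec (∏ q ∈ S, q) r = u),
          ∏ q ∈ S, localFactor (translateFamily Ψ fun j => (r j : ℤ)) q =
            ∏ q ∈ S, localFactor (translateFamily Ψ fun j => (u j : ℤ)) q := by
        intro r hr
        rw [← (mem_filter.1 hr).2]
        exact Finset.prod_congr rfl fun q hq =>
          (localFactor_translateFamily_modVec Ψ
            (Finset.dvd_prod_of_mem (fun i : ℕ => i) hq : q ∣ ∏ i ∈ S, i) r).symm
      rw [Finset.sum_congr rfl fun r hr => by rw [hF r hr], ← Finset.sum_mul,
        Gallagher.sum_filter_modVec_eq hp.pos hP'pos hcop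
          (fun r : Fin m → ℕ => localFactor (translateFamily Ψ fun j => (r j : ℤ)) p)
          (fun r => localFactor_translateFamily_modVec Ψ (dvd_refl p) r) hu,
        sum_localFactor_translateFamily Ψ hp.pos m]
    rw [Finset.sum_congr rfl hinner, ← Finset.mul_sum, ih', Nat.cast_mul, mul_pow]
    ring

/-! ### Step 5: transfer to an arbitrary integer box -/

/-- Reduction modulo `P` is a bijection from the integer box `∏_j [a_j, a_j + P)` onto
`[0, P)^m ⊆ ℕ^m` preserving every coordinate modulo `P`; hence a function of `H mod P` has the same
sum over both. -/
theorem sum_box_eq_sum_range_of_periodic {P : ℕ} (hP : 0 < P) (F : (Fin m → ℤ) → ℝ)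
    (hF : ∀ H H' : Fin m → ℤ, (∀ j, H j ≡ H' j [ZMOD P]) → F H = F H') (a : Fin m → ℤ) :
    ∑ H ∈ Fintype.piFinset (fun j : Fin m => Ico (a j) (a j + P)), F H =
      ∑ u ∈ Fintype.piFinset (fun _ : Fin m => range P), F (fun j => (u j : ℤ)) := by
  have hP0 : (P : ℤ) ≠ 0 := by exact_mod_cast hP.ne'
  have hP0' : (0 : ℤ) < P := by exact_mod_cast hP
  refine Finset.sum_nbij' (fun H j => (H j % (P : ℤ)).toNat)
    (fun u j => a j + ((u j : ℤ) - a j) % (P : ℤ)) ?_ ?_ ?_ ?_ ?_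
  · intro H _
    simp only [Fintype.mem_piFinset, mem_range]
    intro j
    have h1 := Int.emod_nonneg (H j) hP0
    have h2 := Int.emod_lt_of_pos (H j) hP0'
    omega
  · intro u _
    simp only [Fintype.mem_piFinset, mem_Ico]
    intro j
    have h1 := Int.emod_nonneg ((u j : ℤ) - a j) hP0
    have h2 := Int.emod_lt_of_pos ((u j : ℤ) - a j) hP0'
    constructor <;> omega
  · intro H hH
    funext j
    have hj := mem_Ico.1 (Fintype.mem_piFinset.1 hH j)
    dsimp only
    rw [Int.toNat_of_nonneg (Int.emod_nonneg _ hP0)]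
    have h1 : (H j % P - a j) % (P : ℤ) = (H j - a j) % P := (Int.mod_modEq _ _).sub_right _
    rw [h1, Int.emod_eq_of_lt (by omega) (by omega)]
    omega
  · intro u hu
    funext j
    have hj := mem_range.1 (Fintype.mem_piFinset.1 hu j)
    dsimp only
    have h1 : (a j + ((u j : ℤ) - a j) % P) % (P : ℤ) = (u j : ℤ) % P := by
      have h2 : a j + ((u j : ℤ) - a j) % P ≡ a j + ((u j : ℤ) - a j) [ZMOD P] :=
        (Int.mod_modEq _ _).add_left _
      rwa [add_sub_cancel] at h2
    rw [h1, Int.emod_eq_of_lt (by omega) (by omega), Int.toNat_natCast]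
  · intro H _
    refine hF H _ fun j => ?_
    dsimp only
    rw [Int.toNat_of_nonneg (Int.emod_nonneg _ hP0)]
    exact (Int.mod_modEq _ _).symm

/-! ### The stub -/

/-- **B2a holds** (LOCAL FACTORS MULTIPLY EXACTLY ON AVERAGE, Gallagher): for a finite set `S` of
primes with product `P` and any integer box `∏_j [a_j, a_j + P)`,
`∑_{H ∈ box} ∏_{p ∈ S} β_p(Ψ^{(H)}) = P^m ∏_{p ∈ S} β_p(Ψ)^{m+1}`. -/
theorem stub_localAverage : LocalAverage := by
  intro m t Ψ S hS a
  have hPpos : 0 < ∏ p ∈ S, p := Finset.prod_pos fun p hp => (hS p hp).pos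
  have hPZ : (∏ p ∈ S, (p : ℤ)) = ((∏ p ∈ S, p : ℕ) : ℤ) := by push_cast; rfl
  have hper : ∀ H H' : Fin m → ℤ, (∀ j, H j ≡ H' j [ZMOD ((∏ p ∈ S, p : ℕ) : ℤ)]) →
      ∏ p ∈ S, localFactor (translateFamily Ψ H) p =
        ∏ p ∈ S, localFactor (translateFamily Ψ H') p :=
    fun H H' h => Finset.prod_congr rfl fun p hp =>
      localFactor_translateFamily_congr Ψ fun j =>
        (h j).of_dvd (Int.natCast_dvd_natCast.2 (Finset.dvd_prod_of_mem _ hp))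
  rw [hPZ]
  refine (sum_box_eq_sum_range_of_periodic hPpos _ hper a).trans ?_
  exact sum_prod_localFactor_translateFamily Ψ m S hS

end Summit.Parity.GeneralizedHardyLittlewood.Cruxes.RelativeDimOne.TranslateAmplification
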